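import Summits.CriticalPhenomena.PercolationContinuityZ3.Theorems.PercAnnulusCrossingOSSSAnnulus
import HarnessLib

/-!
# RSW3 lane (lead, gen 19): OSSS FOR CROSSINGS, IIa — Kesten's block `{0..L}` read on the box cube of `Λ(N)`: the block incidence, the
# hyperplane seed sets, the event identity `boxCross L i = {H_0 ↔ H_{L_i}}`, and the probability / pivotality bridges

builds on p205010 (kernel theorem, internal audit signed; external expert review pending) — NOT used in this file (every `p`, every `d`).

Cell `prim-rsw3` (LANE 3), lead seat, gen 19.  Support file (`--supports stmt-CriticalPhenomena-4575`); no definitions, no named facts,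
no sorries.  The block `B = {0..L} = Finset.Icc 0 L ⊆ ℤ^d` is read on the box cube of `Λ(N)` ⊇ `B` (`HutchcroftVolumeBoxCube`: all pairs of `Λ(N)`
as coordinates, bias `p` on lattice edges), with the BLOCK incidence (a lattice edge of `Λ(N)` is an edge of the explored graph iff both endpoints lie
in `B`) and the HYPERPLANE seed sets `H_s = {v ∈ B : v_i = s}`; both are written INLINE as lambdas / set-builder terms — this file declares no definitions and no notation.
Part IIb (`…OSSSBoxCross.lean`) does the separation, the revealment bound and the OSSS inequality.

* `blockEdge_symm`, `blockEdge_eq_some_iff`, `blockEdge_ends`, `yAdj_blockEdge_iff` — the block incidence is a symmetric simple-graph incidence;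
* `mem_block_of_yReach`, `pathIn_block_of_yReach`, `yReach_block_of_pathIn` — open block paths of the cube are the open lattice paths inside `B`;
* **`sconn_hyperplanes_iff_mem_boxCross`** — on lattice configurations, `boxCross L i` holds iff `H_0` is joined to `H_{L_i}` by an open block path;
* `sum_wt_gcross_hyperplanes_eq` (`Σ_x w(x)·𝟙{H_0 ↔ H_{L_i}}(x) = P_p(boxCross L i)`), `sconn_block_mono`, `real_pivotal_boxCross_eq_pivCross`,
  `bias_mul_pivCross_hyperplanes_eq` (Russo's term `P_p(e ∈ E(ℤ^d), e pivotal)` is the `p(1−p)`-weighted cube pivotality).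

References: Duminil-Copin–Raoufi–Tassion, Ann. of Math. 189 (2019) §3; Dewan–Muirhead, PTRF (2022) Lemma 2.9; Kesten (1982) §3.3; Russo (1981).
-/

noncomputable section

namespace Summit.CriticalPhenomena.PercolationContinuityZ3.Theorems.Crossing

open MeasureTheory Finset Function
open Literature.Probability.Percolation Literature.Probability.LatticeModels
open Literature.Probability.ODonnellSaksSchrammServedio2005
open Literature.Probability.ODonnellSaksSchrammServedio2005.Strategy
open Literature.Probability.Percolation.GhostExploration Literature.Probability.Percolation.SeedExploration
open Literature.Probability.Percolation.OneArmOSSS Literature.Probability.Percolation.DCT16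
open Summit.CriticalPhenomena.PercolationContinuityZ3.Theorems.SurfaceTension
open Summit.CriticalPhenomena.PercolationContinuityZ3.Theorems.CrossingRevealment

variable {d : ℕ} (L : Site d) (i : Fin d) (N : ℕ)

/-! ## §1 The block read on the box cube -/

/-- The block incidence is symmetric. [cite: DuminilCopinRaoufiTassion2019, §3 Lemma 3.2 (undirected finite graph)] -/
theorem blockEdge_symm (a b : BoxV d N) : (fun a b : BoxV d N => if a.1 ∈ Icc 0 L ∧ b.1 ∈ Icc 0 L then latEdge d N a b else none) a b =
    (fun a b : BoxV d N => if a.1 ∈ Icc 0 L ∧ b.1 ∈ Icc 0 L then latEdge d N a b else none) b a := by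
  simp only
  by_cases h : a.1 ∈ Finset.Icc (0 : Site d) L ∧ b.1 ∈ Finset.Icc (0 : Site d) L
  · rw [if_pos h, if_pos (And.symm h), latEdge_symm]
  · rw [if_neg h, if_neg (fun h' => h (And.symm h'))]

/-- A block label is a lattice label with both endpoints in the block. [cite: DuminilCopinRaoufiTassion2019, §3 Lemma 3.2 (the edges of the finite graph)] -/
theorem blockEdge_eq_some_iff {a b : BoxV d N} {e : PairIdx d N} :
    (fun a b : BoxV d N => if a.1 ∈ Icc 0 L ∧ b.1 ∈ Icc 0 L then latEdge d N a b else none) a b = some e ↔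
      (a.1 ∈ Finset.Icc (0 : Site d) L ∧ b.1 ∈ Finset.Icc (0 : Site d) L) ∧ latEdge d N a b = some e := by
  simp only
  by_cases h : a.1 ∈ Finset.Icc (0 : Site d) L ∧ b.1 ∈ Finset.Icc (0 : Site d) L
  · rw [if_pos h]; exact ⟨fun h' => ⟨h, h'⟩, fun h' => h'.2⟩
  · rw [if_neg h]; exact ⟨fun h' => absurd h' (by simp), fun h' => absurd h'.1 h⟩

/-- Block labels have unique endpoints. [cite: DuminilCopinRaoufiTassion2019, §3 Lemma 3.2 (simple graph)] -/
theorem blockEdge_ends (e : PairIdx d N) (a b a' b' : BoxV d N) (h :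
    (fun a b : BoxV d N => if a.1 ∈ Icc 0 L ∧ b.1 ∈ Icc 0 L then latEdge d N a b else none) a b = some e) (h' :
    (fun a b : BoxV d N => if a.1 ∈ Icc 0 L ∧ b.1 ∈ Icc 0 L then latEdge d N a b else none) a' b' = some e) :
    a' = a ∨ a' = b :=
  latEdge_ends N e a b a' b' ((blockEdge_eq_some_iff L N).1 h).2 ((blockEdge_eq_some_iff L N).1 h').2

/-- Open adjacency for the block incidence: both endpoints in the block and an open lattice edge of the cube.
[cite: DuminilCopinRaoufiTassion2019, §3 Lemma 3.2 (open edges)] -/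
theorem yAdj_blockEdge_iff {y : PairIdx d N → Bool} {a b : BoxV d N} :
    YAdj (fun a b : BoxV d N => if a.1 ∈ Icc 0 L ∧ b.1 ∈ Icc 0 L then latEdge d N a b else none) y a b ↔
      (a.1 ∈ Finset.Icc (0 : Site d) L ∧ b.1 ∈ Finset.Icc (0 : Site d) L) ∧ YAdj (latEdge d N) y a b := by
  unfold YAdj
  constructor
  · rintro ⟨hne, e, he, hy⟩
    obtain ⟨hB, he'⟩ := (blockEdge_eq_some_iff L N).1 he
    exact ⟨hB, hne, e, he', hy⟩
  · rintro ⟨hB, hne, e, he, hy⟩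
    exact ⟨hne, e, (blockEdge_eq_some_iff L N).2 ⟨hB, he⟩, hy⟩

/-- A block path stays in the block. [cite: Kesten1982, §3.3 Def. 1–3 (paths inside the block)] -/
theorem mem_block_of_yReach {y : PairIdx d N → Bool} {a b : BoxV d N} (h : YReach
    (fun a b : BoxV d N => if a.1 ∈ Icc 0 L ∧ b.1 ∈ Icc 0 L then latEdge d N a b else none) y a b)
    (ha : a.1 ∈ Finset.Icc (0 : Site d) L) : b.1 ∈ Finset.Icc (0 : Site d) L := by
  unfold YReach at h
  induction h with
  | refl => exact ha
  | tail _ hvw _ => exact ((yAdj_blockEdge_iff L N).1 hvw).1.2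

/-- An open block path of the cube is an open lattice path inside the block.
[cite: DuminilCopinRaoufiTassion2019, §3 Lemma 3.2 (the events u ↔ Z inside the finite graph)] -/
theorem pathIn_block_of_yReach {ω : BondConfig (Site d)} {a b : BoxV d N} (h : YReach
    (fun a b : BoxV d N => if a.1 ∈ Icc 0 L ∧ b.1 ∈ Icc 0 L then latEdge d N a b else none) (toCube N ω) a b)
    (ha : a.1 ∈ Finset.Icc (0 : Site d) L) :
    PathIn (openGraph ω) (↑(Finset.Icc (0 : Site d) L) : Set (Site d)) a.1 b.1 := by
  refine ⟨Finset.mem_coe.2 ha, ?_⟩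
  unfold YReach at h
  induction h with
  | refl => exact Relation.ReflTransGen.refl
  | @tail v w _ hvw ih =>
    obtain ⟨hB, hne, hadj, hy⟩ := (yAdj_blockEdge_iff L N).1 hvw |>.imp_right (fun h => yAdj_latEdge_iff.1 h)
    refine Relation.ReflTransGen.tail ih ⟨?_, Finset.mem_coe.2 hB.2⟩
    rw [openGraph_adj]
    simp only [toCube, decide_eq_true_eq] at hy
    exact ⟨hy, fun h => hne (Subtype.ext h)⟩

/-- Conversely, for a configuration of lattice edges and a block inside `Λ(N)`, an open lattice path inside the block is an open block path of
the cube. [cite: DuminilCopinRaoufiTassion2019, §3 Lemma 3.2 (the events u ↔ Z inside the finite graph)] -/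
theorem yReach_block_of_pathIn (hLN : Finset.Icc (0 : Site d) L ⊆ box d N) {ω : BondConfig (Site d)} (hω : ω ⊆ (zdGraph d).edgeSet)
    {a b : BoxV d N} (h : PathIn (openGraph ω) (↑(Finset.Icc (0 : Site d) L) : Set (Site d)) a.1 b.1) :
    YReach (fun a b : BoxV d N => if a.1 ∈ Icc 0 L ∧ b.1 ∈ Icc 0 L then latEdge d N a b else none) (toCube N ω) a b := by
  suffices H : ∀ y : Site d,
      Relation.ReflTransGen (fun u v => (openGraph ω).Adj u v ∧ v ∈ (↑(Finset.Icc (0 : Site d) L) : Set (Site d))) a.1 y →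
      ∀ hy : y ∈ box d N, YReach
          (fun a b : BoxV d N => if a.1 ∈ Icc 0 L ∧ b.1 ∈ Icc 0 L then latEdge d N a b else none) (toCube N ω) a ⟨y, hy⟩ from H b.1 h.2 b.2
  intro y hy
  have haB : a.1 ∈ Finset.Icc (0 : Site d) L := Finset.mem_coe.1 h.1
  induction hy with
  | refl => intro _; exact Relation.ReflTransGen.refl
  | @tail c e' hac hcd ih =>
    intro he'
    obtain ⟨hadj, he'B⟩ := hcd
    rw [openGraph_adj] at hadj
    obtain ⟨hmem, hne⟩ := hadj
    have hcB : c ∈ Finset.Icc (0 : Site d) L := by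
      rcases Relation.ReflTransGen.cases_tail hac with h0 | ⟨b', _, hcb⟩
      · rw [h0]; exact haB
      · exact Finset.mem_coe.1 hcb.2
    have hc : c ∈ box d N := hLN hcB
    have hlat : (zdGraph d).Adj c e' := by
      have := hω hmem
      rwa [SimpleGraph.mem_edgeSet] at this
    refine Relation.ReflTransGen.tail (ih hc) ((yAdj_blockEdge_iff L N).2 ⟨⟨hcB, Finset.mem_coe.1 he'B⟩,
      yAdj_latEdge_iff.2 ⟨fun h => hne (congrArg Subtype.val h), hlat, ?_⟩⟩)
    simp only [toCube, decide_eq_true_eq]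
    exact hmem


/-- **THE EVENT IDENTITY**: on lattice configurations, Kesten's `i`-crossing `boxCross L i` of the block `{0..L} ⊆ Λ(N)` holds iff the face
`H_0 = {v ∈ {0..L} : v_i = 0}` is joined to the face `H_{L_i}` by an open block path of the cube.
[cite: Kesten1982, §3.3 Def. 1–3] [cite: DewanMuirhead2022, §2 Lemma 2.9 (Cross_k(R) determined by the exploration of the block)] -/
theorem sconn_hyperplanes_iff_mem_boxCross (hLN : Finset.Icc (0 : Site d) L ⊆ box d N) {ω : BondConfig (Site d)}
    (hω : ω ⊆ (zdGraph d).edgeSet) :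
    SConn (fun a b : BoxV d N => if a.1 ∈ Icc 0 L ∧ b.1 ∈ Icc 0 L then latEdge d N a b else none) {v : BoxV d N | v.1 ∈ Icc 0 L ∧ v.1 i = 0}
        {v : BoxV d N | v.1 ∈ Icc 0 L ∧ v.1 i = L i} (toCube N ω) ↔ ω ∈ boxCross L i := by
  constructor
  · rintro ⟨u, ⟨huB, hu0⟩, b, ⟨hbB, hbL⟩, hub⟩
    exact ⟨u.1, huB, b.1, hbB, hu0, hbL, mem_openConnIn_of_pathIn (pathIn_block_of_yReach L N hub huB)⟩
  · rintro ⟨x, hx, y, hy, hx0, hyL, hxy⟩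
    have hpath := pathIn_of_mem_openConnIn hxy
    exact ⟨⟨x, hLN hx⟩, ⟨hx, hx0⟩, ⟨y, hLN hy⟩, ⟨hy, hyL⟩,
      yReach_block_of_pathIn L N hLN hω (a := ⟨x, hLN hx⟩) (b := ⟨y, hLN hy⟩) hpath⟩

/-- THE FIRST BRIDGE: `Σ_x w(x)·𝟙{H_0 ↔ H_{L_i}}(x) = P_p(boxCross L i)` on the box cube of `Λ(N) ⊇ {0..L}`.
[cite: DuminilCopinRaoufiTassion2019, §3 proof of Thm 1.2 (θ_n = μ[f])] -/
theorem sum_wt_gcross_hyperplanes_eq (hLN : Finset.Icc (0 : Site d) L ⊆ box d N) (p : unitInterval) :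
    ∑ x : PairIdx d N → Bool, wt (boxBias d N p) x * gcross (fun a b : BoxV d N => if a.1 ∈ Icc 0 L ∧ b.1 ∈ Icc 0 L then latEdge d N a b else none)
        {v : BoxV d N | v.1 ∈ Icc 0 L ∧ v.1 i = 0} {v : BoxV d N | v.1 ∈ Icc 0 L ∧ v.1 i = L i} x = boxCrossProb d p L i := by
  classical
  have hev : (bondPercolation (zdGraph d) p).real {ω | SConn (fun a b : BoxV d N => if a.1 ∈ Icc 0 L ∧ b.1 ∈ Icc 0 L then latEdge d N a b else none)
      {v : BoxV d N | v.1 ∈ Icc 0 L ∧ v.1 i = 0} {v : BoxV d N | v.1 ∈ Icc 0 L ∧ v.1 i = L i} (toCube N ω)} = boxCrossProb d p L i :=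
    real_congr_of_forall_subset_edgeSet (zdGraph d) p fun _ hω => sconn_hyperplanes_iff_mem_boxCross L i N hLN hω
  rw [← hev, real_setOf_toCube N p (fun x => SConn (fun a b : BoxV d N => if a.1 ∈ Icc 0 L ∧ b.1 ∈ Icc 0 L then latEdge d N a b else none)
      {v : BoxV d N | v.1 ∈ Icc 0 L ∧ v.1 i = 0} {v : BoxV d N | v.1 ∈ Icc 0 L ∧ v.1 i = L i} x)]
  rfl

/-- `𝟙{X ↔ Y}` for the block incidence is increasing: opening pairs preserves the crossing. [cite: Kesten1982, §3.3 (crossing events are increasing)] -/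
theorem sconn_block_mono {X Y : Set (BoxV d N)} {x x' : PairIdx d N → Bool} (hle : ∀ e, x e = true → x' e = true)
    (h : SConn (fun a b : BoxV d N => if a.1 ∈ Icc 0 L ∧ b.1 ∈ Icc 0 L then latEdge d N a b else none) X Y x) : SConn
        (fun a b : BoxV d N => if a.1 ∈ Icc 0 L ∧ b.1 ∈ Icc 0 L then latEdge d N a b else none) X Y x' := by
  obtain ⟨u, hu, b, hb, hr⟩ := h
  exact ⟨u, hu, b, hb, yReach_mono hle hr⟩

/-- THE PIVOTALITY BRIDGE: for a lattice pair `e` of `Λ(N)`, `P_p(e pivotal for boxCross L i) = Σ_y w(y)·(𝟙(y^{e→1}) − 𝟙(y^{e→0}))`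
(`pivCross` of the two faces for the block incidence). [cite: RussoZW1981, §4 Lemma 3 (4.2)] [cite: DewanMuirhead2022, §2 eq. (2.4)] -/
theorem real_pivotal_boxCross_eq_pivCross (hLN : Finset.Icc (0 : Site d) L ⊆ box d N) (p : unitInterval) (e : PairIdx d N)
    (he : e.1 ∈ (zdGraph d).edgeSet) :
    (bondPercolation (zdGraph d) p).real {ω | e.1 ∈ (zdGraph d).edgeSet ∧ IsPivotal (boxCross L i) e.1 ω}
      = pivCross (fun a b : BoxV d N => if a.1 ∈ Icc 0 L ∧ b.1 ∈ Icc 0 L then latEdge d N a b else none) (boxBias d N p)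
          {v : BoxV d N | v.1 ∈ Icc 0 L ∧ v.1 i = 0} {v : BoxV d N | v.1 ∈ Icc 0 L ∧ v.1 i = L i} e := by
  classical
  set P : (PairIdx d N → Bool) → Prop := fun x => SConn (fun a b : BoxV d N => if a.1 ∈ Icc 0 L ∧ b.1 ∈ Icc 0 L then latEdge d N a b else none)
      {v : BoxV d N | v.1 ∈ Icc 0 L ∧ v.1 i = 0} {v : BoxV d N | v.1 ∈ Icc 0 L ∧ v.1 i = L i} x with hP
  have hae : (bondPercolation (zdGraph d) p).real {ω | e.1 ∈ (zdGraph d).edgeSet ∧ IsPivotal (boxCross L i) e.1 ω}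
      = (bondPercolation (zdGraph d) p).real {ω | IsPivotal {ω | P (toCube N ω)} e.1 ω} := by
    have hiff : ∀ ω, ω ⊆ (zdGraph d).edgeSet → (IsPivotal (boxCross L i) e.1 ω ↔ IsPivotal {ω | P (toCube N ω)} e.1 ω) := by
      intro ω hω
      have h1 : insert e.1 ω ⊆ (zdGraph d).edgeSet := Set.insert_subset he hω
      have h2 : ω \ {e.1} ⊆ (zdGraph d).edgeSet := fun x hx => hω hx.1
      have e1 : insert e.1 ω ∈ boxCross L i ↔ insert e.1 ω ∈ {ω | P (toCube N ω)} :=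
        (sconn_hyperplanes_iff_mem_boxCross L i N hLN h1).symm
      have e2 : ω \ {e.1} ∈ boxCross L i ↔ ω \ {e.1} ∈ {ω | P (toCube N ω)} :=
        (sconn_hyperplanes_iff_mem_boxCross L i N hLN h2).symm
      unfold IsPivotal
      rw [e1, e2]
    refine le_antisymm ?_ ?_
    · exact real_mono_of_forall_subset_edgeSet (zdGraph d) p fun ω hω h => (hiff ω hω).1 h.2
    · exact real_mono_of_forall_subset_edgeSet (zdGraph d) p fun ω hω h => ⟨he, (hiff ω hω).2 h⟩
  rw [hae]
  have hmono : ∀ x : PairIdx d N → Bool, P (update x e false) → P (update x e true) := by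
    intro x h
    refine sconn_block_mono L N (fun e' he' => ?_) h
    by_cases hee : e' = e
    · subst hee; simp at he'
    · rwa [update_of_ne hee] at he' ⊢
  have hev : {ω : BondConfig (Site d) | IsPivotal {ω | P (toCube N ω)} e.1 ω}
      = {ω | P (update (toCube N ω) e true) ∧ ¬ P (update (toCube N ω) e false)} := by
    ext ω
    simp only [Set.mem_setOf_eq, IsPivotal, toCube_insert, toCube_sdiff]
    constructor
    · intro h
      rcases h with ⟨h1, h2⟩ | ⟨h1, h2⟩
      · exact ⟨h1, h2⟩
      · exact absurd (hmono _ h1) h2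
    · rintro ⟨h1, h2⟩
      exact Or.inl ⟨h1, h2⟩
  rw [hev, real_setOf_toCube N p (fun x => P (update x e true) ∧ ¬ P (update x e false))]
  unfold pivCross
  refine Finset.sum_congr rfl fun x _ => ?_
  congr 1
  unfold gcross
  by_cases h1 : P (update x e true) <;> by_cases h0 : P (update x e false)
  · rw [if_pos h1, if_pos h0, if_neg (fun h => h.2 h0)]; ring
  · rw [if_pos h1, if_neg h0, if_pos ⟨h1, h0⟩]; ring
  · exact absurd (hmono x h0) h1
  · rw [if_neg h1, if_neg h0, if_neg (fun h => h1 h.1)]; ring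

/-- The cube pivotality for the block incidence weighted by `b_e(1−b_e)` is `p(1−p)` times Russo's term (both vanish off the lattice edges).
[cite: RussoZW1981, §4 Lemma 3 (4.2)] -/
theorem bias_mul_pivCross_hyperplanes_eq (hLN : Finset.Icc (0 : Site d) L ⊆ box d N) (p : unitInterval) (e : PairIdx d N) :
    boxBias d N p e * (1 - boxBias d N p e) * pivCross
        (fun a b : BoxV d N => if a.1 ∈ Icc 0 L ∧ b.1 ∈ Icc 0 L then latEdge d N a b else none) (boxBias d N p)
        {v : BoxV d N | v.1 ∈ Icc 0 L ∧ v.1 i = 0} {v : BoxV d N | v.1 ∈ Icc 0 L ∧ v.1 i = L i} e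
      = (p : ℝ) * (1 - p) * (bondPercolation (zdGraph d) p).real {ω | e.1 ∈ (zdGraph d).edgeSet ∧ IsPivotal (boxCross L i) e.1 ω} := by
  classical
  by_cases he : e.1 ∈ (zdGraph d).edgeSet
  · rw [real_pivotal_boxCross_eq_pivCross L i N hLN p e he]
    unfold boxBias; rw [if_pos he]
  · have h0 : (bondPercolation (zdGraph d) p).real {ω | e.1 ∈ (zdGraph d).edgeSet ∧ IsPivotal (boxCross L i) e.1 ω} = 0 := by
      have : {ω : BondConfig (Site d) | e.1 ∈ (zdGraph d).edgeSet ∧ IsPivotal (boxCross L i) e.1 ω} = ∅ := by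
        ext ω; simp [he]
      rw [this, measureReal_empty]
    rw [h0]
    unfold boxBias; rw [if_neg he]; ring

end Summit.CriticalPhenomena.PercolationContinuityZ3.Theorems.Crossing

end
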